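import Summits.ABC.IUTFork.ForkGenuineWindowSharp
import Literature.IUT.LogVolume.TensorPacketFactorDifferentBound
import Literature.Algebra.PolynomialIdentities.WeightedAverages
import HarnessLib

/-!
# The fork at [IUTchIII] Corollary 3.12 at a GENUINE input: the sharp lower window with the factor-field
# differents BOUNDED — `D♯(I) ≥ Σ_p ((ℓ⋇+3)/2·Σ_u Pr(u)·d_u − Σ_u d_u)·log p` ([IUTchIV] §1; Dupuy–Hilado §4.12)

Record-only PROOF file (D-0012) of the abc-iut cell (campaign-S seat abc-iut-S4, gen 6); TAKES NO SIDE.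
Sequel to abc-iut-w6-d018's `ForkGenuineWindowSharp` (R2 TARGET #1 «Rest_lower»): there
`−ndegLgpSlotMin(P_Θ; T(I)) + D♯(I) ≤ negLogThetaNonarch I` with
`D♯(I) = Σ_{p∈T(I)} (1/ℓ⋇) Σ_j Σ_{v⃗} (d_I(v⃗) − min_J d_{L_J}(v⃗))·log p·Π_b Pr(v_b)`, the different `min_J d_{L_J}(v⃗)` of
the least factor field of the packet `⊗_b K_{v̲_b}` being left as a term (evaluated by w6-d018 only for collections
`v⃗` all of whose slots carry ONE NORMAL completion). With the uniform bound of
`TensorPacketFactorDifferentBound.inf_differentOrd_dFac_comp_le_dSum` — **`min_J d_{L_J}(v⃗) ≤ Σ_{u|p} d(K_{u̲})` for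
EVERY collection `v⃗ ∈ V(F₀)_p^{j+1}`**, mixed or not, normal or not — `D♯(I)` is bounded below by a CLOSED FORM in
the differents of the completions alone:

* `dExplicitTerm_le_dSharpTerm` — per collection: `d_I(v⃗) − Σ_{u|p} d(K_{u̲}) ≤ d_I(v⃗) − min_J d_{L_J}(v⃗)`;
* **`neg_ndegLgpSlotMin_add_dExplicit_le_negLogThetaNonarch`** —
  `−ndegLgpSlotMin + D_expl(I) ≤ negLogThetaNonarch I` with
  `D_expl(I) := Σ_{p∈T(I)} (1/ℓ⋇) Σ_j Σ_{v⃗} (d_I(v⃗) − Σ_{u|p} d(K_{u̲}))·log p·Π Pr` (spelled inline);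
* **`slotResidue_add_dExplicit_le_of_hullEstimateOf`** — `HullEstimateOf I δ → slotResidue(T(I)) + D_expl(I) ≤ δ`;
* **`dExplicit_eq_closedForm`** — by [IUTchIV] Prop. 1.7 (the tree's `WeightedAverage.mul_betaTotal_mul_lamTotal_pow`,
  `Σ_{v⃗} (Σ_b d_{v_b})·Π Pr(v_b) = (j+1)·Σ_u Pr(u)·d_u`, `Σ_{v⃗} Π Pr = 1`) and (E1):
  **`D_expl(I) = Σ_{p∈T(I)} (((ℓ⋇+3)/2)·Σ_{u|p} Pr(u)·d(K_{u̲}) − Σ_{u|p} d(K_{u̲}))·log p`** — i.e. the FULL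
  `(l+5)/4·log(𝔡^K_{v_ℚ})`-shaped different term that [IUTchIV] Thm. 1.10 Step (v) ALLOCATES (p. 28–29:
  "`(j+1)·log(𝔡^K_{v_ℚ})` … `((l+5)/4)·log(𝔡^K_{v_ℚ})`") is REALISED by the genuine volume, up to ONE unweighted copy
  `Σ_{u|p} d(K_{u̲})·log p` per support prime;
* `slotResidue_add_closedForm_le_of_hullEstimateOf` — the same in closed form; and at the `λ`-line
  `PointDict.slotResidue_add_dExplicit_le_of_hullVolumeAtDatum` — `Cor22.HullVolumeAtDatum P l δ` (the `hvol` binder;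
  the `stub_hullRegimeAbove` conclusion of stmt-ABC-19678's skeleton with `δ = B(P,l)`) forces
  `slotResidue(T) + D_expl(T) ≤ δ` at EVERY genuine datum `T`.

READING for VERDICT ¶7 (numbers, not a side). `B(P,l) = (l+1)/4·{(1+12d_mod/l)(log 𝔡^{F_tpd} + log 𝔣^{F_tpd}) +
2 log l + 52 + (20/3)·l*_mod·log 𝔰^≤}` was obtained in print as an UPPER bound for
`(l+1)/4·{(1+4/l)·log(𝔡^K) + (4/l)·log(𝔰^ℚ) + (20/3)·l*_mod·log(𝔰^≤)}` (Steps (ii)–(iii), p. 24–26), whose leading term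
`(l+5)/4·log(𝔡^K) = Σ_p ((ℓ⋇+3)/2)·Σ_u Pr(u)·d(K_{u̲})·log p` is exactly the leading term of `D_expl`. So on the
union line (ii′-U) the slack `B(P,l) − D_expl(T)` that must absorb `slotResidue(T)` consists of print's own rounding
in Steps (ii), (iii), (viii) (`(8 d_mod/l)·(…)`, `2 log l + 52`, the prime-counting term) plus one copy
`Σ_p Σ_{u|p} d(K_{u̲})·log p` — NOT of the full `(l+1)/4·(log 𝔡 + log 𝔣)`. Nothing here asserts `HullEstimateOf`,
`Cor312Of` or the existence of any datum; (Ind1)/(Ind2)/hull are the tree's typings of the disputed corpus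
[claim: Mochizuki2012, status: disputed]; the algebra is classical. No side taken on [IUTchIII] Cor. 3.12; typed ≠
proved. PROOF-ONLY file: no definitions, no named `Prop` facts.
[cite: DupuyHilado2025, Def. 3.6.3, §4.9, §4.12] [cite: Mochizuki2012, IUTchIV Prop. 1.1 p. 9, Prop. 1.7 p. 16–17]
[cite: Mochizuki2012, IUTchIV Thm. 1.10 Steps (iv)–(viii) p. 26–30]
-/

noncomputable section

open Set Literature.IUT.LogVolume NumberField IsDedekindDomain
open scoped Pointwise

namespace Summit.ABC.IUTFork.GenuineContent

section Explicit

variable {F₀ : Type} [Field F₀] [NumberField F₀] {K : Type} [Field K] [NumberField K] [Algebra F₀ K]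
variable (I : ThetaVolumeInput F₀ K)

/-! ## 1. Per collection: the least factor different is at most `Σ_{u|p} d(K_{u̲})` -/

/-- **Per collection `v⃗ ∈ V(F₀)_p^{j+1}`: `d_I(v⃗) − Σ_{u|p} d(K_{u̲}) ≤ d_I(v⃗) − min_J d_{L_J}(v⃗)`** — the packet
`⊗_b K_{v̲_b}` is drawn from the finite stock `(K_{u̲})_{u|p}`, so some factor field embeds in a factor of the
one-copy packet `⊗_{u|p} K_{u̲}`, whose differents are `≤ Σ_{u|p} d(K_{u̲})`
(`TensorPacketFactorDifferentBound.inf_differentOrd_dFac_comp_le_dSum`). [cite: Mochizuki2012, IUTchIV Prop. 1.1 p. 9] -/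
theorem dExplicitTerm_le_dSharpTerm {p : ℕ} [hp : Fact p.Prime] (i : Fin I.X.lstar)
    (e : Fin ((i : ℕ) + 1 + 1) → placesOver F₀ p) :
    dSum p (fun b => (I.σ.localFieldFamily p hp.out).k (e b))
        - dSum p (fun u : placesOver F₀ p => (I.σ.localFieldFamily p hp.out).k u) ≤
      dSum p (fun b => (I.σ.localFieldFamily p hp.out).k (e b))
        - (Finset.univ : Finset (DIdx p (fun b => (I.σ.localFieldFamily p hp.out).k (e b)))).inf'
            Finset.univ_nonempty
            (fun J => differentOrd p (DFac p (fun b => (I.σ.localFieldFamily p hp.out).k (e b)) J)) := by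
  classical
  haveI : Nonempty (placesOver F₀ p) := ⟨e 0⟩
  have h := inf_differentOrd_dFac_comp_le_dSum p (fun u : placesOver F₀ p => (I.σ.localFieldFamily p hp.out).k u) e
  linarith

/-! ## 2. The GLOBAL explicit lower window -/

/-- **GLOBAL EXPLICIT LOWER END**: `−ndegLgpSlotMin(P_Θ; T(I)) + D_expl(I) ≤ negLogThetaNonarch I` with
`D_expl(I) := Σ_{p∈T(I)} (1/ℓ⋇)·Σ_j Σ_{v⃗} (d_I(v⃗) − Σ_{u|p} d(K_{u̲}))·log p·Π_b Pr(v_b)` (spelled inline) — w6-d018's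
`neg_ndegLgpSlotMin_add_dSharp_le_negLogThetaNonarch` with `min_J d_{L_J}(v⃗)` bounded by `Σ_{u|p} d(K_{u̲})` at
every collection. Unconditional. [cite: DupuyHilado2025, Def. 3.6.3, §4.12] [cite: Mochizuki2012, IUTchIV Prop. 1.1 p. 9] -/
theorem neg_ndegLgpSlotMin_add_dExplicit_le_negLogThetaNonarch :
    -I.X.ndegLgpSlotMin I.supportPrimes
        + ∑ p ∈ I.supportPrimes, (1 / (I.X.lstar : ℝ)) * ∑ i : Fin I.X.lstar,
            ∑ e : Fin ((i : ℕ) + 1 + 1) → placesOver F₀ p,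
              (if hp : p.Prime then
                haveI : Fact p.Prime := ⟨hp⟩
                (dSum p (fun b => (I.σ.localFieldFamily p hp).k (e b))
                  - dSum p (fun u : placesOver F₀ p => (I.σ.localFieldFamily p hp).k u)) * Real.log p
               else 0) * ∏ b, weight F₀ (e b).1 ≤
      I.negLogThetaNonarch := by
  refine le_trans ?_ (neg_ndegLgpSlotMin_add_dSharp_le_negLogThetaNonarch I)
  refine add_le_add le_rfl (Finset.sum_le_sum fun p hpT => ?_)
  have hp' : p.Prime := I.prime_of_mem_supportPrimes hpT
  haveI hp : Fact p.Prime := ⟨hp'⟩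
  refine mul_le_mul_of_nonneg_left (Finset.sum_le_sum fun i _ => Finset.sum_le_sum fun e _ => ?_)
    (one_div_lstar_nonneg I)
  refine mul_le_mul_of_nonneg_right ?_ (prod_weight_nonneg e)
  simp only [dif_pos hp']
  exact mul_le_mul_of_nonneg_right (dExplicitTerm_le_dSharpTerm I i e)
    (Real.log_nonneg (by exact_mod_cast hp'.one_lt.le))

/-- **Every hull-volume estimate pays the slot residue AND the explicit different gain**:
`HullEstimateOf I δ → slotResidue(P_Θ; T(I)) + D_expl(I) ≤ δ`.
[cite: DupuyHilado2025, Thm. 3.10.1, §4.12] [cite: Mochizuki2012, IUTchIV Thm. 1.10 Steps (v)–(viii) p. 27–30] -/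
theorem slotResidue_add_dExplicit_le_of_hullEstimateOf {δ : ℝ} (h : I.HullEstimateOf δ) :
    I.X.slotResidue I.supportPrimes
        + ∑ p ∈ I.supportPrimes, (1 / (I.X.lstar : ℝ)) * ∑ i : Fin I.X.lstar,
            ∑ e : Fin ((i : ℕ) + 1 + 1) → placesOver F₀ p,
              (if hp : p.Prime then
                haveI : Fact p.Prime := ⟨hp⟩
                (dSum p (fun b => (I.σ.localFieldFamily p hp).k (e b))
                  - dSum p (fun u : placesOver F₀ p => (I.σ.localFieldFamily p hp).k u)) * Real.log p
               else 0) * ∏ b, weight F₀ (e b).1 ≤ δ := by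
  have hl := neg_ndegLgpSlotMin_add_dExplicit_le_negLogThetaNonarch I
  have hs : I.X.slotResidue I.supportPrimes =
      LgpDivisor.ndegLgp I.X.thetaPilot - I.X.ndegLgpSlotMin I.supportPrimes := (DHData.ofInput I).slotResidue_eq
  unfold ThetaVolumeInput.HullEstimateOf at h
  rw [hs]
  linarith

/-! ## 3. The closed form of `D_expl` ([IUTchIV] Prop. 1.7 and (E1)) -/

/-- `Σ_{i<n} (i+2) = n(n+3)/2` (real form). [folklore] -/
private theorem sum_fin_add_two (n : ℕ) : ∑ i : Fin n, ((i : ℕ) + 2 : ℝ) = (n : ℝ) * ((n : ℝ) + 3) / 2 := by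
  rw [Fin.sum_univ_eq_sum_range (fun i => ((i : ℝ) + 2)) n]
  induction n with
  | zero => simp
  | succ m ih =>
    rw [Finset.sum_range_succ, ih]
    push_cast
    ring

/-- **[IUTchIV] Prop. 1.7 at a prime, for the differents**: for every degree `j = i+1`,
`Σ_{v⃗ ∈ V(F₀)_p^{j+1}} (d_I(v⃗) − Σ_u d(K_{u̲}))·log p·Π_b Pr(v_b) = ((j+1)·Σ_u Pr(u)·d(K_{u̲}) − Σ_u d(K_{u̲}))·log p`
("after passing to weighted averages … `(j+1)·log(𝔡^K_{v_ℚ})`", Step (v) p. 28–29; the tree's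
`WeightedAverage.mul_betaTotal_mul_lamTotal_pow` with `λ_u = Pr(u)`, `Σ_u Pr(u) = 1`).
[cite: Mochizuki2012, IUTchIV Prop. 1.7 p. 16–17, Thm. 1.10 Step (v) p. 28–29] -/
theorem sum_dExplicitTerm_mul_prod_weight_eq {p : ℕ} [hp : Fact p.Prime] (i : Fin I.X.lstar) :
    ∑ e : Fin ((i : ℕ) + 1 + 1) → placesOver F₀ p,
        (dSum p (fun b => (I.σ.localFieldFamily p hp.out).k (e b))
          - dSum p (fun u : placesOver F₀ p => (I.σ.localFieldFamily p hp.out).k u)) * Real.log p *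
          ∏ b, weight F₀ (e b).1 =
      ((((i : ℕ) + 2 : ℝ)) * ∑ u : placesOver F₀ p, weight F₀ u.1 * differentOrd p ((I.σ.localFieldFamily p hp.out).k u)
        - dSum p (fun u : placesOver F₀ p => (I.σ.localFieldFamily p hp.out).k u)) * Real.log p := by
  classical
  set d : placesOver F₀ p → ℝ := fun u => differentOrd p ((I.σ.localFieldFamily p hp.out).k u) with hd
  set w : placesOver F₀ p → ℝ := fun u => weight F₀ u.1 with hw
  -- Prop. 1.7, third display: `(m+1)·β_E·λ_E^m = Σ_e β_e·λ_Πe` with `β = d`, `λ = Pr`, `m = i+1`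
  have h17 := Literature.Algebra.PolynomialIdentities.WeightedAverage.mul_betaTotal_mul_lamTotal_pow d w ((i : ℕ) + 1)
  have hlam : Literature.Algebra.PolynomialIdentities.WeightedAverage.lamTotal w = 1 := (localWeights F₀ p).sum_pr
  rw [hlam, one_pow, mul_one] at h17
  -- `Σ_e Π Pr = (Σ Pr)^{j+1} = 1`
  have hone : ∑ e : Fin ((i : ℕ) + 1 + 1) → placesOver F₀ p, ∏ b, weight F₀ (e b).1 = 1 := by
    rw [← Fintype.sum_pow (f := fun v : placesOver F₀ p => weight F₀ v.1) ((i : ℕ) + 1 + 1)]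
    have h1 : ∑ v : placesOver F₀ p, weight F₀ v.1 = 1 := (localWeights F₀ p).sum_pr
    rw [h1, one_pow]
  have hbt : Literature.Algebra.PolynomialIdentities.WeightedAverage.betaTotal d w =
      ∑ u : placesOver F₀ p, weight F₀ u.1 * differentOrd p ((I.σ.localFieldFamily p hp.out).k u) := by
    simp only [Literature.Algebra.PolynomialIdentities.WeightedAverage.betaTotal, hd, hw]
    exact Finset.sum_congr rfl fun u _ => mul_comm _ _
  -- unfold the bookkeeping
  have hsplit : ∀ e : Fin ((i : ℕ) + 1 + 1) → placesOver F₀ p,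
      (dSum p (fun b => (I.σ.localFieldFamily p hp.out).k (e b))
          - dSum p (fun u : placesOver F₀ p => (I.σ.localFieldFamily p hp.out).k u)) * Real.log p *
          ∏ b, weight F₀ (e b).1 =
        Real.log p * (Literature.Algebra.PolynomialIdentities.WeightedAverage.tupleBeta d e *
            Literature.Algebra.PolynomialIdentities.WeightedAverage.tupleLam w e) -
          Real.log p * dSum p (fun u : placesOver F₀ p => (I.σ.localFieldFamily p hp.out).k u) *
            ∏ b, weight F₀ (e b).1 := by
    intro e
    simp only [Literature.Algebra.PolynomialIdentities.WeightedAverage.tupleBeta,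
      Literature.Algebra.PolynomialIdentities.WeightedAverage.tupleLam, hd, hw, dSum]
    ring
  rw [Finset.sum_congr rfl fun e _ => hsplit e, Finset.sum_sub_distrib, ← Finset.mul_sum, ← Finset.mul_sum,
    ← h17, hone, hbt]
  push_cast
  ring

/-- **THE CLOSED FORM**: `D_expl(I) = Σ_{p∈T(I)} (((ℓ⋇+3)/2)·Σ_{u|p} Pr(u)·d(K_{u̲}) − Σ_{u|p} d(K_{u̲}))·log p` — the
procession average `(1/ℓ⋇)·Σ_{j=1}^{ℓ⋇}(j+1) = (ℓ⋇+3)/2` ((E1), Step (v) p. 29: "`((l⋇+3)/2)·log(𝔡^K_{v_ℚ})` … `=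
((l+5)/4)·log(𝔡^K_{v_ℚ})`") of the weighted averages of `sum_dExplicitTerm_mul_prod_weight_eq`.
[cite: Mochizuki2012, IUTchIV Thm. 1.10 Step (i) (E1) p. 23, Step (v) p. 28–29] -/
theorem dExplicit_eq_closedForm :
    ∑ p ∈ I.supportPrimes, (1 / (I.X.lstar : ℝ)) * ∑ i : Fin I.X.lstar,
        ∑ e : Fin ((i : ℕ) + 1 + 1) → placesOver F₀ p,
          (if hp : p.Prime then
            haveI : Fact p.Prime := ⟨hp⟩
            (dSum p (fun b => (I.σ.localFieldFamily p hp).k (e b))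
              - dSum p (fun u : placesOver F₀ p => (I.σ.localFieldFamily p hp).k u)) * Real.log p
           else 0) * ∏ b, weight F₀ (e b).1 =
      ∑ p ∈ I.supportPrimes,
        (if hp : p.Prime then
          haveI : Fact p.Prime := ⟨hp⟩
          ((((I.X.lstar : ℝ) + 3) / 2) *
              ∑ u : placesOver F₀ p, weight F₀ u.1 * differentOrd p ((I.σ.localFieldFamily p hp).k u)
            - dSum p (fun u : placesOver F₀ p => (I.σ.localFieldFamily p hp).k u)) * Real.log p
         else 0) := by
  refine Finset.sum_congr rfl fun p hpT => ?_
  have hp' : p.Prime := I.prime_of_mem_supportPrimes hpT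
  haveI hp : Fact p.Prime := ⟨hp'⟩
  simp only [dif_pos hp']
  have hl0 : (I.X.lstar : ℝ) ≠ 0 := by
    have := I.X.two_le_lstar
    exact_mod_cast (by omega : I.X.lstar ≠ 0)
  set B : ℝ := ∑ u : placesOver F₀ p, weight F₀ u.1 * differentOrd p ((I.σ.localFieldFamily p hp').k u) with hB
  set D : ℝ := dSum p (fun u : placesOver F₀ p => (I.σ.localFieldFamily p hp').k u) with hD
  have hinner : ∀ i : Fin I.X.lstar, ∑ e : Fin ((i : ℕ) + 1 + 1) → placesOver F₀ p,
      (dSum p (fun b => (I.σ.localFieldFamily p hp').k (e b)) - D) * Real.log p * ∏ b, weight F₀ (e b).1 =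
        ((((i : ℕ) + 2 : ℝ)) * B - D) * Real.log p := fun i =>
    sum_dExplicitTerm_mul_prod_weight_eq I i
  rw [Finset.sum_congr rfl fun i _ => hinner i]
  have hlin : ∀ i : Fin I.X.lstar, ((((i : ℕ) + 2 : ℝ)) * B - D) * Real.log p =
      (B * Real.log p) * ((i : ℕ) + 2 : ℝ) + (-(D * Real.log p)) := fun i => by ring
  simp_rw [hlin]
  rw [Finset.sum_add_distrib, ← Finset.mul_sum, sum_fin_add_two, Finset.sum_const, Finset.card_univ,
    Fintype.card_fin, nsmul_eq_mul]
  field_simp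
  ring

/-- **Every hull-volume estimate pays the slot residue AND `Σ_p ((ℓ⋇+3)/2·Σ_u Pr(u)d_u − Σ_u d_u)·log p`** (closed
form of `slotResidue_add_dExplicit_le_of_hullEstimateOf`): the `(l+5)/4·log(𝔡^K)`-shaped term that [IUTchIV] Thm. 1.10
Step (v) allocates to the hull is CONSUMED by the genuine hull volume up to one unweighted copy per prime, so a
hull-volume estimate with discrepancy `δ` leaves only `δ − Σ_p ((ℓ⋇+3)/2·Σ_u Pr(u)d_u − Σ_u d_u)·log p` for the
(Ind1) slot residue. Nothing asserted about any input. [cite: Mochizuki2012, IUTchIV Thm. 1.10 Step (v) p. 27–29]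
[cite: DupuyHilado2025, §4.12] -/
theorem slotResidue_add_closedForm_le_of_hullEstimateOf {δ : ℝ} (h : I.HullEstimateOf δ) :
    I.X.slotResidue I.supportPrimes
        + ∑ p ∈ I.supportPrimes,
            (if hp : p.Prime then
              haveI : Fact p.Prime := ⟨hp⟩
              ((((I.X.lstar : ℝ) + 3) / 2) *
                  ∑ u : placesOver F₀ p, weight F₀ u.1 * differentOrd p ((I.σ.localFieldFamily p hp).k u)
                - dSum p (fun u : placesOver F₀ p => (I.σ.localFieldFamily p hp).k u)) * Real.log p
             else 0) ≤ δ := by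
  rw [← dExplicit_eq_closedForm I]
  exact slotResidue_add_dExplicit_le_of_hullEstimateOf I h

/-- **The two-sided ARITHMETIC window, explicit lower side**: for every genuine input `I` and every `δ`,
`slotResidue + explicitDeltaRest ≤ δ ⟹ HullEstimateOf I δ ⟹ slotResidue + Σ_p((ℓ⋇+3)/2·Σ_u Pr(u)d_u − Σ_u d_u)·log p ≤ δ`
(sufficient side: abc-iut-c312-d1/S8 via w6-d018's `hullEstimateOf_of_slotResidue_add_rest_le`). Pure packaging.
[cite: Mochizuki2012, IUTchIV Thm. 1.10 Step (v) p. 27–28] [cite: DupuyHilado2025, §4.12] -/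
theorem hullEstimateOf_window_explicit (δ : ℝ) :
    (I.X.slotResidue I.supportPrimes + DHData.explicitDeltaRest I ≤ δ → I.HullEstimateOf δ) ∧
    (I.HullEstimateOf δ →
      I.X.slotResidue I.supportPrimes
        + ∑ p ∈ I.supportPrimes,
            (if hp : p.Prime then
              haveI : Fact p.Prime := ⟨hp⟩
              ((((I.X.lstar : ℝ) + 3) / 2) *
                  ∑ u : placesOver F₀ p, weight F₀ u.1 * differentOrd p ((I.σ.localFieldFamily p hp).k u)
                - dSum p (fun u : placesOver F₀ p => (I.σ.localFieldFamily p hp).k u)) * Real.log p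
             else 0) ≤ δ) :=
  ⟨hullEstimateOf_of_slotResidue_add_rest_le I, slotResidue_add_closedForm_le_of_hullEstimateOf I⟩

end Explicit

end Summit.ABC.IUTFork.GenuineContent

/-! ## 4. At the `λ`-line -/

namespace Summit.ABC.IUTFork.PointDict

open Literature.NumberTheory.DiophantineGeometry.GenEll

variable {P : NFPoint} {l : ℕ}

/-- **`Cor22.HullVolumeAtDatum P l δ` forces `slotResidue(T) + Σ_p((ℓ⋇+3)/2·Σ_u Pr(u)d_u − Σ_u d_u)·log p ≤ δ`
at EVERY genuine datum `T` of `(P, l)`** (the `hvol` binder of `Conditional/AbcOfS*` and the `stub_hullRegimeAbove`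
conclusion of stmt-ABC-19678's skeleton carry `δ = B(P,l)`): on the union line the estimate compares the (Ind1)
slot residue with the slack `B(P,l) − Σ_p((ℓ⋇+3)/2·Σ_u Pr(u)d_u − Σ_u d_u)·log p`, the subtracted term being the
genuine `(l+5)/4·log(𝔡^K)` of the datum's field `K` up to one unweighted different per support prime. Nothing
asserted about the existence of data; no side taken. [claim: Mochizuki2012, status: disputed] -/
theorem slotResidue_add_closedForm_le_of_hullVolumeAtDatum {δ : ℝ} (h : Cor22.HullVolumeAtDatum P l δ)
    (T : Cor22.ThetaVolumeDatumAt P l) :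
    (letI := T.instFieldF; letI := T.instNumberFieldF; letI := T.instFieldK; letI := T.instNumberFieldK
     letI := T.instAlgebraK; letI := T.instIsElliptic
     T.I.X.slotResidue T.I.supportPrimes
        + ∑ p ∈ T.I.supportPrimes,
            (if hp : p.Prime then
              haveI : Fact p.Prime := ⟨hp⟩
              ((((T.I.X.lstar : ℝ) + 3) / 2) *
                  ∑ u : placesOver (Literature.IUT.HodgeTheaters.fieldOfModuli T.E) p,
                    weight (Literature.IUT.HodgeTheaters.fieldOfModuli T.E) u.1 *
                      differentOrd p ((T.I.σ.localFieldFamily p hp).k u)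
                - dSum p (fun u : placesOver (Literature.IUT.HodgeTheaters.fieldOfModuli T.E) p =>
                    (T.I.σ.localFieldFamily p hp).k u)) * Real.log p
             else 0)) ≤ δ := by
  letI := T.instFieldF; letI := T.instNumberFieldF; letI := T.instFieldK; letI := T.instNumberFieldK
  letI := T.instAlgebraK; letI := T.instIsElliptic
  exact GenuineContent.slotResidue_add_closedForm_le_of_hullEstimateOf T.I (h T)

end Summit.ABC.IUTFork.PointDict

end
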